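import Mathlib
import Summits.BirchSwinnertonDyer.BirchSwinnertonDyer.Theorems.KatoDescentTamePotSupersingularTameLowerFibreAdjointBricksFiveGalois
import Literature.NumberTheory.EllipticCurves.GreenbergSelmerNewformDatum

/-!
# Bricks for the `GL₂(𝔽₅)`-lifting route (T5′), XXI: `Gal(ℚ̄/ℚ(ζ_{5^∞}))` as a kernel, unit-ball subrings of a
# finite `L/ℚ₅`, and the currency of an integral newform datum (`GreenbergSelmer.padicCoeffIntegers ι`,
# `OrdinaryNewformDatum.ρ`) — the desk's T1 `LatticeClause` shape from the residual covering

Continuation of file XX (`…AdjointBricksFiveGalois`, same namespace). Packagings of the end form of XX for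
consumers; no new group theory:

* **§1 `Γ₀` as a kernel.** `isClosed_ker_of_continuous`, `commutator_mem_ker`: the kernel of a continuous
  homomorphism to a commutative T₁ group (e.g. the cyclotomic character, whose kernel on `G_ℚ` is
  `Gal(ℚ̄/ℚ(ζ_{5^∞}))`) is a closed subgroup containing the commutators, so XIX applies with `Γ₀ := χ.ker`:
  `exists_conj_SL2_le_range_ker_padicInt` / `…_intermediateFieldIntegers` (ARM-P r07 ADD-12 P.S. 2,
  INFO I-S7-14 (2)).
* **§2 Unit-ball subrings.** For `L ⊆ ℚ̄₅` finite over `ℚ₅` and ANY subring `S ≤ L` with carrier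
  `{x : |x|₅ ≤ 1}` (so `S = 𝒪_L` as a set, through the identity isomorphism `S ≃+* intermediateFieldIntegers 5 L`,
  a homeomorphism): `exists_conj_SL2_le_image_absoluteGaloisGroup_unitBallSubring` — a CONTINUOUS
  `ρ : Γ_K →* GL₂(S)` whose reduction covers `GL₂(𝔽₅)`, DISPLAYED in norm form `|ρ(γ)_{ij} − q_{ij}| < 1`, admits
  `u` with `|u_{ij} − δ_{ij}| < 1` and `u·φ(s)·u⁻¹ = ρ σ` (`σ` fixing every root of unity) for every
  `φ : ℤ₅ → S`, `s ∈ SL₂(ℤ₅)`; and `exists_latticeClause_of_residual_covering_unitBallSubring` — **the shape of the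
  desk's typed referee statement T1 `LatticeClause` (bsd-cited r07 S7 §E): `∃ P ∈ GL₂(S), ∀ A ∈ SL₂(ℤ₅), ∃ σ`
  (here: fixing all roots of unity), `(P·ρ(σ)·P⁻¹` read in `ℚ̄₅) = A` (read through `ℤ₅ → ℚ₅ → ℚ̄₅`)** — the
  structure map `ℤ₅ → 𝒪_L → S` of XIX supplies `φ`.
* **§3 The coefficient ring of an integral newform datum.** For a cusp form `g` and an embedding
  `ι : K_g → ℚ̄₅`, the tree's `GreenbergSelmer.padicCoeffIntegers ι` (`= {x ∈ ℚ₅(ι K_g) : |x| ≤ 1}`, the ring `𝒪`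
  of `OrdinaryNewformDatum`, EPW §3.1) is such an `S` inside `L = padicCoeffField ι`
  (`toSubring_intermediateFieldIntegers_padicCoeffField`), whence
  `exists_conj_SL2_le_image_absoluteGaloisGroup_padicCoeffIntegers`, `exists_latticeClause_of_residual_covering`
  and its specialisation `exists_latticeClause_of_residual_covering_newformDatum` to `Δ.ρ` for
  `Δ : OrdinaryNewformDatum g 5 ι` (`Δ.ρ : Γ_ℚ →ₜ* GL₂(𝒪)` is continuous by type), under the displayed
  `[FiniteDimensional ℚ_[5] (padicCoeffField ι)]` (`K_g` is a number field — not re-proved here).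

What is NOT discharged (and is not a tree object for a non-rational newform): the residual covering itself
(«`ρ̄_g ≅ ρ̄_W ⊗ k` with `Surj W 5`», Deligne's construction + Chebotarev + Brauer–Nesbitt from the displayed
congruence of Hecke eigenvalues) — it stays a DISPLAYED hypothesis, in norm form. Route-free, no definitions,
nothing about elliptic curves or items 19618/19981 (open). Target T-S7r07-1 (`FibreLatticeInput 5`, Δ1@5).
-/

set_option linter.dupNamespace false

open Matrix IsLocalRing Filter Topology
open scoped MatrixGroups

namespace Summit.BirchSwinnertonDyer.BirchSwinnertonDyer.Theorems.GL2F5AdjointBricks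

/-! ### §1 `Γ₀` as the kernel of a character -/

section kerChi

universe u v

variable {Γ : Type u} [Group Γ] [TopologicalSpace Γ] {T : Type v} [CommGroup T] [TopologicalSpace T]

/-- `GL₂(g) ∘ GL₂(f) = GL₂(g ∘ f)` (pointwise; `rfl`). -/
theorem generalLinearGroup_map_map {R S T' : Type*} [CommRing R] [CommRing S] [CommRing T'] (f : R →+* S)
    (g : S →+* T') (x : GL (Fin 2) R) :
    Matrix.GeneralLinearGroup.map g (Matrix.GeneralLinearGroup.map f x) =
      Matrix.GeneralLinearGroup.map (g.comp f) x := rfl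

/-- `GL₂(f)` is continuous for a continuous ring map `f`. -/
theorem continuous_generalLinearGroup_map {R S : Type*} [CommRing R] [CommRing S] [TopologicalSpace R]
    [TopologicalSpace S] (f : R →+* S) (hf : Continuous f) :
    Continuous (Matrix.GeneralLinearGroup.map (n := Fin 2) f) :=
  Continuous.units_map _ (continuous_id.matrix_map hf)

/-- The kernel of a continuous homomorphism to a T₁ group is closed. -/
theorem isClosed_ker_of_continuous [T1Space T] (χ : Γ →* T) (hχ : Continuous χ) :
    IsClosed (χ.ker : Set Γ) := by
  have e : (χ.ker : Set Γ) = χ ⁻¹' {1} := by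
    ext x; simp only [SetLike.mem_coe, MonoidHom.mem_ker, Set.mem_preimage, Set.mem_singleton_iff]
  rw [e]; exact isClosed_singleton.preimage hχ

omit [TopologicalSpace Γ] [TopologicalSpace T] in
/-- Commutators lie in the kernel of any homomorphism to a commutative group. -/
theorem commutator_mem_ker (χ : Γ →* T) (a b : Γ) : a * b * a⁻¹ * b⁻¹ ∈ χ.ker := by
  rw [MonoidHom.mem_ker, map_mul, map_mul, map_mul, map_inv, map_inv, mul_comm (χ a) (χ b),
    mul_inv_cancel_right, mul_inv_cancel]

variable [CompactSpace Γ] [T1Space T]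

/-- **(C0)+(C1) at `A = ℤ₅` with `Γ₀ = ker χ`.** For a continuous `ρ : Γ → GL₂(ℤ₅)` of a compact group
whose reduction is onto `GL₂(𝔽₅)` and a continuous `χ : Γ → T` to a commutative T₁ group (e.g. the
cyclotomic character, `ker χ = Gal(ℚ̄/ℚ(ζ_{5^∞}))`): some `u ≡ 1 (mod 5)` has every `u·s·u⁻¹`, `s ∈ SL₂(ℤ₅)`,
of the form `ρ γ` with `χ γ = 1`. -/
theorem exists_conj_SL2_le_range_ker_padicInt [Fact (Nat.Prime 5)] (ρ : Γ →* GL (Fin 2) ℤ_[5])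
    (hρ : Continuous ρ) (χ : Γ →* T) (hχ : Continuous χ)
    (hres : ∀ q : GL (Fin 2) (ZMod 5), ∃ γ : Γ, Matrix.GeneralLinearGroup.map PadicInt.toZMod (ρ γ) = q) :
    ∃ u : GL (Fin 2) ℤ_[5], Matrix.GeneralLinearGroup.map PadicInt.toZMod u = 1 ∧
      ∀ s : SL(2, ℤ_[5]), ∃ γ : Γ, χ γ = 1 ∧ ρ γ = u * Matrix.SpecialLinearGroup.toGL s * u⁻¹ := by
  obtain ⟨u, hu1, hu⟩ := exists_conj_SL2_le_range_padicInt ρ hρ χ.ker (isClosed_ker_of_continuous χ hχ)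
    (commutator_mem_ker χ) hres
  refine ⟨u, hu1, fun s => ?_⟩
  obtain ⟨γ, hγ, hγs⟩ := Subgroup.mem_map.1 (hu s).2
  exact ⟨γ, (MonoidHom.mem_ker).1 hγ, hγs⟩

/-- **(C0)+(C1) at `A = 𝒪_L` with `Γ₀ = ker χ`** (every finite `L/ℚ₅` inside `ℚ̄₅`, every `φ : ℤ₅ → 𝒪_L`). -/
theorem exists_conj_SL2_le_range_ker_intermediateFieldIntegers [Fact (Nat.Prime 5)]
    (L : IntermediateField ℚ_[5] (PadicAlgCl 5)) [FiniteDimensional ℚ_[5] L]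
    (ρ : Γ →* GL (Fin 2) (Literature.NumberTheory.GaloisRepresentations.intermediateFieldIntegers 5 L))
    (hρ : Continuous ρ) (χ : Γ →* T) (hχ : Continuous χ)
    (hres : ∀ q : GL (Fin 2) (ZMod 5), ∃ γ : Γ, ∀ i j,
      (ρ γ).val i j - ((q.val i j).val : ℕ) ∈
        maximalIdeal (Literature.NumberTheory.GaloisRepresentations.intermediateFieldIntegers 5 L)) :
    ∃ u : GL (Fin 2) (Literature.NumberTheory.GaloisRepresentations.intermediateFieldIntegers 5 L),
      (∀ i j, u.val i j -
        (1 : Matrix (Fin 2) (Fin 2)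
          (Literature.NumberTheory.GaloisRepresentations.intermediateFieldIntegers 5 L)) i j ∈
        maximalIdeal (Literature.NumberTheory.GaloisRepresentations.intermediateFieldIntegers 5 L)) ∧
      ∀ (φ : ℤ_[5] →+* Literature.NumberTheory.GaloisRepresentations.intermediateFieldIntegers 5 L)
        (s : SL(2, ℤ_[5])), ∃ γ : Γ, χ γ = 1 ∧
          ρ γ = u * Matrix.GeneralLinearGroup.map φ (Matrix.SpecialLinearGroup.toGL s) * u⁻¹ := by
  obtain ⟨u, hu1, hu⟩ := exists_conj_SL2_le_range_intermediateFieldIntegers L ρ hρ χ.ker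
    (isClosed_ker_of_continuous χ hχ) (commutator_mem_ker χ) hres
  refine ⟨u, hu1, fun φ s => ?_⟩
  obtain ⟨γ, hγ, hγs⟩ := Subgroup.mem_map.1 (hu φ s).2
  exact ⟨γ, (MonoidHom.mem_ker).1 hγ, hγs⟩

end kerChi

/-! ### §2 Unit-ball subrings of a finite `L/ℚ₅` — e.g. the coefficient ring `𝒪 = padicCoeffIntegers ι`
of an integral newform datum -/

section unitBall

open scoped ModularForm
open CongruenceSubgroup
open Literature.NumberTheory.GaloisRepresentations Literature.NumberTheory.EllipticCurves.ModularForms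
  Literature.NumberTheory.EllipticCurves.GreenbergSelmer

universe u

variable (K : Type u) [Field K] [Fact (Nat.Prime 5)] (L : IntermediateField ℚ_[5] (PadicAlgCl 5))
  [FiniteDimensional ℚ_[5] L] (S : Subring L) (hS : ∀ x : L, x ∈ S ↔ ‖(x : PadicAlgCl 5)‖ ≤ 1)

set_option maxHeartbeats 400000 in
include hS in
/-- **Kato's (12.5.2) from the residual covering, `A = S` any subring of a finite `L/ℚ₅` with carrier the
closed unit ball** (so `S = 𝒪_L` as a set; e.g. `S = padicCoeffIntegers ι`). Let `ρ : Γ_K → GL₂(S)` be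
CONTINUOUS with reduction covering `GL₂(𝔽₅)`, displayed in norm form: for every `q ∈ GL₂(𝔽₅)` some `ρ γ`
has `|ρ(γ)_{ij} − q_{ij}| < 1`. Then some `u ∈ GL₂(S)` with `|u_{ij} − δ_{ij}| < 1` has: for every ring map
`φ : ℤ₅ → S` and every `s ∈ SL₂(ℤ₅)`, `u·φ(s)·u⁻¹ = ρ σ` for some `σ ∈ Γ_K` fixing every root of unity. -/
theorem exists_conj_SL2_le_image_absoluteGaloisGroup_unitBallSubring
    (ρ : Field.absoluteGaloisGroup K →* GL (Fin 2) S) (hρ : Continuous ρ)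
    (hres : ∀ q : GL (Fin 2) (ZMod 5), ∃ γ : Field.absoluteGaloisGroup K, ∀ i j,
      ‖(((ρ γ).val i j - ((q.val i j).val : ℕ) : S) : L)‖ < 1) :
    ∃ u : GL (Fin 2) S,
      (∀ i j, ‖((u.val i j - (1 : Matrix (Fin 2) (Fin 2) S) i j : S) : L)‖ < 1) ∧
      ∀ (φ : ℤ_[5] →+* S) (s : SL(2, ℤ_[5])), ∃ σ : Field.absoluteGaloisGroup K,
        (∀ (k : ℕ) (t : AlgebraicClosure K), 0 < k → t ^ k = 1 → σ • t = t) ∧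
          ρ σ = u * Matrix.GeneralLinearGroup.map φ (Matrix.SpecialLinearGroup.toGL s) * u⁻¹ := by
  -- the identity isomorphism `e : S ≃ 𝒪_L` and its continuity
  let O := intermediateFieldIntegers 5 L
  obtain ⟨e, hecoe, hesymmcoe, he⟩ : ∃ e : S ≃+* O,
      (∀ x : S, ((e x : O) : L) = (x : L)) ∧ (∀ y : O, ((e.symm y : S) : L) = (y : L)) ∧ Continuous e := by
    let e : S ≃+* O :=
      { toFun := fun x => ⟨(x : L), (mem_intermediateFieldIntegers_iff _ _).2 ((hS _).1 x.2)⟩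
        invFun := fun y => ⟨(y : L), (hS _).2 ((mem_intermediateFieldIntegers_iff _ _).1 y.2)⟩
        left_inv := fun x => rfl
        right_inv := fun y => rfl
        map_mul' := fun x y => rfl
        map_add' := fun x y => rfl }
    exact ⟨e, fun x => rfl, fun y => rfl, continuous_subtype_val.subtype_mk _⟩
  -- transport `ρ` along `e`
  have hρ' : Continuous ((Matrix.GeneralLinearGroup.map e.toRingHom).comp ρ) :=
    (continuous_generalLinearGroup_map e.toRingHom he).comp hρ
  have hres' : ∀ q : GL (Fin 2) (ZMod 5), ∃ γ : Field.absoluteGaloisGroup K, ∀ i j,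
      (((Matrix.GeneralLinearGroup.map e.toRingHom).comp ρ) γ).val i j - ((q.val i j).val : ℕ) ∈
        maximalIdeal O := by
    intro q
    obtain ⟨γ, hγ⟩ := hres q
    refine ⟨γ, fun i j => ?_⟩
    rw [intermediateFieldIntegers.mem_maximalIdeal_iff]
    have e1 : (((Matrix.GeneralLinearGroup.map e.toRingHom).comp ρ) γ).val i j - ((q.val i j).val : ℕ) =
        e ((ρ γ).val i j - ((q.val i j).val : ℕ)) := by
      rw [map_sub, map_natCast]; rfl
    rw [e1, hecoe]
    exact hγ i j
  obtain ⟨u', hu1', hu'⟩ := exists_conj_SL2_le_image_absoluteGaloisGroup_intermediateFieldIntegers K L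
    ((Matrix.GeneralLinearGroup.map e.toRingHom).comp ρ) hρ' hres'
  -- transport back
  have hcomp : e.symm.toRingHom.comp e.toRingHom = RingHom.id _ := RingEquiv.symm_toRingHom_comp_toRingHom e
  have hback : ∀ x : GL (Fin 2) S,
      Matrix.GeneralLinearGroup.map e.symm.toRingHom (Matrix.GeneralLinearGroup.map e.toRingHom x) = x := by
    intro x
    rw [generalLinearGroup_map_map e.toRingHom e.symm.toRingHom, hcomp, Matrix.GeneralLinearGroup.map_id,
      MonoidHom.id_apply]
  refine ⟨Matrix.GeneralLinearGroup.map e.symm.toRingHom u', fun i j => ?_, fun φ s => ?_⟩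
  · have h1 : e.symm ((1 : Matrix (Fin 2) (Fin 2) O) i j) = (1 : Matrix (Fin 2) (Fin 2) S) i j := by
      rw [Matrix.one_apply, Matrix.one_apply]; split_ifs <;> simp
    have e2 : (Matrix.GeneralLinearGroup.map e.symm.toRingHom u').val i j - (1 : Matrix (Fin 2) (Fin 2) S) i j =
        e.symm (u'.val i j - (1 : Matrix (Fin 2) (Fin 2) O) i j) := by
      rw [map_sub, h1]; rfl
    rw [e2, hesymmcoe]
    exact (intermediateFieldIntegers.mem_maximalIdeal_iff _ _).1 (hu1' i j)
  · obtain ⟨σ, hσ, hσs⟩ := hu' (e.toRingHom.comp φ) s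
    refine ⟨σ, hσ, ?_⟩
    have hX : Matrix.GeneralLinearGroup.map e.symm.toRingHom
        (Matrix.GeneralLinearGroup.map (e.toRingHom.comp φ) (Matrix.SpecialLinearGroup.toGL s)) =
        Matrix.GeneralLinearGroup.map φ (Matrix.SpecialLinearGroup.toGL s) := by
      refine Units.ext (Matrix.ext fun i j => ?_)
      exact e.symm_apply_apply (φ (s i j))
    have hσs' : Matrix.GeneralLinearGroup.map e.toRingHom (ρ σ) =
        u' * Matrix.GeneralLinearGroup.map (e.toRingHom.comp φ) (Matrix.SpecialLinearGroup.toGL s) * u'⁻¹ := by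
      rw [← MonoidHom.comp_apply (Matrix.GeneralLinearGroup.map e.toRingHom) ρ σ]
      exact hσs
    have h1 : ρ σ = Matrix.GeneralLinearGroup.map e.symm.toRingHom
        (Matrix.GeneralLinearGroup.map e.toRingHom (ρ σ)) := (hback (ρ σ)).symm
    have h2 := congrArg (Matrix.GeneralLinearGroup.map e.symm.toRingHom) hσs'
    have h3 : Matrix.GeneralLinearGroup.map e.symm.toRingHom
        (u' * Matrix.GeneralLinearGroup.map (e.toRingHom.comp φ) (Matrix.SpecialLinearGroup.toGL s) * u'⁻¹) =
        Matrix.GeneralLinearGroup.map e.symm.toRingHom u' *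
          Matrix.GeneralLinearGroup.map e.symm.toRingHom
            (Matrix.GeneralLinearGroup.map (e.toRingHom.comp φ) (Matrix.SpecialLinearGroup.toGL s)) *
          (Matrix.GeneralLinearGroup.map e.symm.toRingHom u')⁻¹ := by
      rw [map_mul, map_mul, map_inv]
    have h4 : Matrix.GeneralLinearGroup.map e.symm.toRingHom u' *
          Matrix.GeneralLinearGroup.map e.symm.toRingHom
            (Matrix.GeneralLinearGroup.map (e.toRingHom.comp φ) (Matrix.SpecialLinearGroup.toGL s)) *
          (Matrix.GeneralLinearGroup.map e.symm.toRingHom u')⁻¹ =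
        Matrix.GeneralLinearGroup.map e.symm.toRingHom u' *
          Matrix.GeneralLinearGroup.map φ (Matrix.SpecialLinearGroup.toGL s) *
          (Matrix.GeneralLinearGroup.map e.symm.toRingHom u')⁻¹ :=
      congrArg (fun Z => Matrix.GeneralLinearGroup.map e.symm.toRingHom u' * Z *
        (Matrix.GeneralLinearGroup.map e.symm.toRingHom u')⁻¹) hX
    exact h1.trans (h2.trans (h3.trans h4))

include hS in
/-- **The desk's typed referee statement T1 `LatticeClause` (bsd-cited r07 S7 §E) from the residual
covering**, for `A = S` a unit-ball subring of a finite `L/ℚ₅`: there is `P ∈ GL₂(S)` such that for every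
`A ∈ SL₂(ℤ₅)` some `σ ∈ Γ_K` fixing every root of unity has `P · ρ(σ) · P⁻¹`, read in `GL₂(ℚ̄₅)`, equal to
`A` (read through `ℤ₅ → ℚ₅ → ℚ̄₅`). -/
theorem exists_latticeClause_of_residual_covering_unitBallSubring
    (ρ : Field.absoluteGaloisGroup K →* GL (Fin 2) S) (hρ : Continuous ρ)
    (hres : ∀ q : GL (Fin 2) (ZMod 5), ∃ γ : Field.absoluteGaloisGroup K, ∀ i j,
      ‖(((ρ γ).val i j - ((q.val i j).val : ℕ) : S) : L)‖ < 1) :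
    ∃ P : GL (Fin 2) S, ∀ A : SL(2, ℤ_[5]), ∃ σ : Field.absoluteGaloisGroup K,
      (∀ (k : ℕ) (t : AlgebraicClosure K), 0 < k → t ^ k = 1 → σ • t = t) ∧
        ((P * ρ σ * P⁻¹ : GL (Fin 2) S) : Matrix (Fin 2) (Fin 2) S).map
            (fun x : S => ((x : L) : PadicAlgCl 5)) =
          (A : Matrix (Fin 2) (Fin 2) ℤ_[5]).map ((algebraMap ℚ_[5] (PadicAlgCl 5)).comp PadicInt.Coe.ringHom) := by
  obtain ⟨u, -, hu⟩ := exists_conj_SL2_le_image_absoluteGaloisGroup_unitBallSubring K L S hS ρ hρ hres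
  -- the structure map `ℤ₅ → 𝒪_L → S`
  obtain ⟨φ₀, hφ₀⟩ := exists_ringHom_padicInt_intermediateFieldIntegers L
  let eback : intermediateFieldIntegers 5 L →+* S :=
    { toFun := fun y => ⟨(y : L), (hS _).2 ((mem_intermediateFieldIntegers_iff _ _).1 y.2)⟩
      map_one' := rfl
      map_mul' := fun x y => rfl
      map_zero' := rfl
      map_add' := fun x y => rfl }
  let φ : ℤ_[5] →+* S := eback.comp φ₀
  have hφ : ∀ x : ℤ_[5], (((φ x : S) : L) : PadicAlgCl 5) =
      ((algebraMap ℚ_[5] (PadicAlgCl 5)).comp PadicInt.Coe.ringHom) x := by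
    intro x
    show (((φ₀ x : intermediateFieldIntegers 5 L) : L) : PadicAlgCl 5) = algebraMap ℚ_[5] (PadicAlgCl 5) (x : ℚ_[5])
    rw [hφ₀ x]
    exact (IsScalarTower.algebraMap_apply ℚ_[5] L (PadicAlgCl 5) _).symm
  refine ⟨u⁻¹, fun A => ?_⟩
  obtain ⟨σ, hσ, hσs⟩ := hu φ A
  refine ⟨σ, hσ, ?_⟩
  have hconj : u⁻¹ * ρ σ * u⁻¹⁻¹ = Matrix.GeneralLinearGroup.map φ (Matrix.SpecialLinearGroup.toGL A) := by
    rw [hσs, inv_inv, ← mul_assoc, ← mul_assoc, inv_mul_cancel, one_mul, mul_assoc, inv_mul_cancel, mul_one]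
  rw [hconj]
  ext i j
  rw [Matrix.map_apply, Matrix.map_apply, Matrix.GeneralLinearGroup.map_apply,
    Matrix.SpecialLinearGroup.coe_GL_coe_matrix, hφ]

end unitBall

/-! ### §3 The coefficient ring `𝒪 = padicCoeffIntegers ι` of an integral newform datum -/

section newformDatum

open scoped ModularForm
open CongruenceSubgroup
open Literature.NumberTheory.GaloisRepresentations Literature.NumberTheory.EllipticCurves.ModularForms
  Literature.NumberTheory.EllipticCurves.GreenbergSelmer

universe u

variable {Γ : Subgroup (GL (Fin 2) ℝ)} {k : ℤ} {g : CuspForm Γ k} [Fact (Nat.Prime 5)]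
  (ι : coeffField g →+* PadicAlgCl 5)

/-- The ring `𝒪 = padicCoeffIntegers ι` of the tree's integral newform data has the same carrier as the
ring of integers `intermediateFieldIntegers 5 (padicCoeffField ι)` of `K = ℚ₅(ι K_g)`. -/
theorem toSubring_intermediateFieldIntegers_padicCoeffField :
    (intermediateFieldIntegers 5 (padicCoeffField ι)).toSubring = padicCoeffIntegers ι := by
  ext x
  rw [ValuationSubring.mem_toSubring, mem_intermediateFieldIntegers_iff, mem_padicCoeffIntegers_iff]

variable (K : Type u) [Field K] [FiniteDimensional ℚ_[5] (padicCoeffField ι)]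

/-- **Kato's (12.5.2) from the residual covering, `A = 𝒪 = padicCoeffIntegers ι`** (the coefficient ring
of an integral newform datum; `K/ℚ₅` finite displayed as an instance hypothesis): for a CONTINUOUS
`ρ : Γ_K → GL₂(𝒪)` with reduction covering `GL₂(𝔽₅)` (norm form), some `u ∈ GL₂(𝒪)` with
`|u_{ij} − δ_{ij}| < 1` has `u·φ(s)·u⁻¹ = ρ σ`, `σ` fixing every root of unity, for every `φ : ℤ₅ → 𝒪`,
`s ∈ SL₂(ℤ₅)`. -/
theorem exists_conj_SL2_le_image_absoluteGaloisGroup_padicCoeffIntegers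
    (ρ : Field.absoluteGaloisGroup K →* GL (Fin 2) (padicCoeffIntegers ι)) (hρ : Continuous ρ)
    (hres : ∀ q : GL (Fin 2) (ZMod 5), ∃ γ : Field.absoluteGaloisGroup K, ∀ i j,
      ‖padicCoeffIntegers.toPadicAlgCl ι ((ρ γ).val i j - ((q.val i j).val : ℕ))‖ < 1) :
    ∃ u : GL (Fin 2) (padicCoeffIntegers ι),
      (∀ i j, ‖padicCoeffIntegers.toPadicAlgCl ι
        (u.val i j - (1 : Matrix (Fin 2) (Fin 2) (padicCoeffIntegers ι)) i j)‖ < 1) ∧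
      ∀ (φ : ℤ_[5] →+* padicCoeffIntegers ι) (s : SL(2, ℤ_[5])), ∃ σ : Field.absoluteGaloisGroup K,
        (∀ (k : ℕ) (t : AlgebraicClosure K), 0 < k → t ^ k = 1 → σ • t = t) ∧
          ρ σ = u * Matrix.GeneralLinearGroup.map φ (Matrix.SpecialLinearGroup.toGL s) * u⁻¹ :=
  exists_conj_SL2_le_image_absoluteGaloisGroup_unitBallSubring K (padicCoeffField ι) (padicCoeffIntegers ι)
    (mem_padicCoeffIntegers_iff ι) ρ hρ hres

/-- **T1 `LatticeClause` for `𝒪 = padicCoeffIntegers ι`** from the residual covering: some `P ∈ GL₂(𝒪)` has,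
for every `A ∈ SL₂(ℤ₅)`, a `σ ∈ Γ_K` fixing every root of unity with `(P·ρ(σ)·P⁻¹` read in `ℚ̄₅) = A`. -/
theorem exists_latticeClause_of_residual_covering
    (ρ : Field.absoluteGaloisGroup K →* GL (Fin 2) (padicCoeffIntegers ι)) (hρ : Continuous ρ)
    (hres : ∀ q : GL (Fin 2) (ZMod 5), ∃ γ : Field.absoluteGaloisGroup K, ∀ i j,
      ‖padicCoeffIntegers.toPadicAlgCl ι ((ρ γ).val i j - ((q.val i j).val : ℕ))‖ < 1) :
    ∃ P : GL (Fin 2) (padicCoeffIntegers ι), ∀ A : SL(2, ℤ_[5]), ∃ σ : Field.absoluteGaloisGroup K,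
      (∀ (k : ℕ) (t : AlgebraicClosure K), 0 < k → t ^ k = 1 → σ • t = t) ∧
        ((P * ρ σ * P⁻¹ : GL (Fin 2) (padicCoeffIntegers ι)) :
            Matrix (Fin 2) (Fin 2) (padicCoeffIntegers ι)).map (padicCoeffIntegers.toPadicAlgCl ι) =
          (A : Matrix (Fin 2) (Fin 2) ℤ_[5]).map ((algebraMap ℚ_[5] (PadicAlgCl 5)).comp PadicInt.Coe.ringHom) :=
  exists_latticeClause_of_residual_covering_unitBallSubring K (padicCoeffField ι) (padicCoeffIntegers ι)
    (mem_padicCoeffIntegers_iff ι) ρ hρ hres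

/-- **T1 `LatticeClause Δ` for an integral ordinary newform datum** (the tree's
`GreenbergSelmer.OrdinaryNewformDatum g 5 ι`), from the DISPLAYED residual covering of `Δ.ρ` and
`[FiniteDimensional ℚ_[5] (padicCoeffField ι)]`: some `P ∈ GL₂(𝒪)` conjugates `Δ.ρ(Gal(ℚ̄/ℚ(ζ_∞)))` onto a
group whose image in `GL₂(ℚ̄₅)` contains `SL₂(ℤ₅)`. -/
theorem exists_latticeClause_of_residual_covering_newformDatum {M : ℕ} {k' : ℤ}
    {g' : CuspForm (Gamma0 M) k'} (ι' : coeffField g' →+* PadicAlgCl 5)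
    [FiniteDimensional ℚ_[5] (padicCoeffField ι')] (Δ : OrdinaryNewformDatum g' 5 ι')
    (hres : ∀ q : GL (Fin 2) (ZMod 5), ∃ γ : Field.absoluteGaloisGroup ℚ, ∀ i j,
      ‖padicCoeffIntegers.toPadicAlgCl ι' ((Δ.ρ γ).val i j - ((q.val i j).val : ℕ))‖ < 1) :
    ∃ P : GL (Fin 2) (padicCoeffIntegers ι'), ∀ A : SL(2, ℤ_[5]), ∃ σ : Field.absoluteGaloisGroup ℚ,
      (∀ (k : ℕ) (t : AlgebraicClosure ℚ), 0 < k → t ^ k = 1 → σ • t = t) ∧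
        ((P * Δ.ρ σ * P⁻¹ : GL (Fin 2) (padicCoeffIntegers ι')) :
            Matrix (Fin 2) (Fin 2) (padicCoeffIntegers ι')).map (padicCoeffIntegers.toPadicAlgCl ι') =
          (A : Matrix (Fin 2) (Fin 2) ℤ_[5]).map ((algebraMap ℚ_[5] (PadicAlgCl 5)).comp PadicInt.Coe.ringHom) :=
  exists_latticeClause_of_residual_covering ι' ℚ Δ.ρ.toMonoidHom (map_continuous Δ.ρ) hres

end newformDatum

end Summit.BirchSwinnertonDyer.BirchSwinnertonDyer.Theorems.GL2F5AdjointBricks
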